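import Summits.BirchSwinnertonDyer.Rank1Residual.Additive.X4ExoticWildArms
import Summits.BirchSwinnertonDyer.Rank1Residual.GaloisImage.HauptmodulExoticSignature
import HarnessLib

/-!
# The EXOTIC residue of X4 at `3` after the Hauptmodul route: wild cell (w) ∧ `v₃(j − 1728) ∈ {3, 0}`
# ∧ [`v₃(j − 1728) = 0` or `(v₃(j), j/3^{v₃(j)} mod 9)` of SIGNATURE type] ∧ no level-`9` `j`-witness
# (cell `b2b-bsdres`, team n1011, seat p02 gen 6 — row T-b11-F4-END, class-currency END; sequel of
# n1011-p14's `Additive/X4ExoticWildArms.lean` and of `GaloisImage/HauptmodulExoticSignature.lean`)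

HONEST FRAMING (cell `b2b-bsdres`, run/shared/lean/b2b/bsd-rank1-residual/, verbatim in every
file): the goal of the cell is to DELETE the COMBINATION-SHAPED residual classes of the
Birch–Swinnerton-Dyer formula for ALL analytic-rank `≤ 1` elliptic curves over `ℚ` — "full BSD
formula for every rank `≤ 1` curve in class `C`" assembled STRICTLY from published theorems — so
that the rank-`≤ 1` remainder becomes exactly the CONSTRUCTION-SHAPED classes, which are TYPED
(missing-input `Prop`s), NOT attempted. This is not "finishing BSD". Team n1011 (N10 / N11, the
additive block X4 ∧ `p = 3`): research route; no claim beyond the stated classes; the label X4 is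
UNCHANGED by this file; nothing is booked. Theorems only (no definition, no named fact minted; every
published input of the end-state is an explicit named-fact hypothesis, as in p251574 and
`X4ExoticWildArms`).

## What this file proves

Write `SIG(V, c)` for the (inlined) predicate
`(V = 3 ∧ c ≡ 8) ∨ (3 ∣ V, V ≥ 6 ∧ c ≡ ±1) ∨ (V = 7 ∧ c ∈ {2, 4}) ∨ (3 ∤ V, V ≥ 8 ∧ c ≡ ±1) (mod 9)`
of `HauptmodulExoticSignature` — the `(v₃(j), j/3^{v₃(j)} mod 9)` types no kernel tower theorem reaches.

* §1 `ClassX4.exotic_hauptmodul_signature_of_not_towerSurj_three` — an X4 pair at `3` with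
  `ρ̄_{E,3}` onto whose `3`-adic tower FAILS lies in (w), has `v₃(j − 1728) ∈ {3, 0}` and `9 ∣ ord_q j`
  at every prime `q ≠ 3` with `ord_q j < 0` (n1011-p14's `ClassX4.exotic_arms_of_not_towerSurj_three`),
  AND `v₃(j − 1728) = 0` or `v₃(j) = V`, `j/3^V ≡ c (mod 9)` with `SIG(V, c)`
  (`exotic_hauptmodul_signature_of_not_towerSurj_three`; on (w) the alternative `v₃(j − 1728) ≤ 0`
  reads `= 0`, `padicValRat_j_sub_1728_nonneg_of_subW`).
* §2 `exotic_arms_iff_exotic_of_hauptmodul_signature` / `exotic_iff_exotic_of_hauptmodul_signature` —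
  the two-arm form, resp. p251574's EXOTIC piece, is EQUIVALENT to the
  same statement on the rows carrying this sharpened signature; and the END-STATE
  **`x4SharpUnitFree_iff_lower_and_residues_sharp_exoticHauptmodul_noL20`** — the eight-fact X4
  end-state (`x4SharpUnitFree_iff_lower_and_residues_sharp_exoticArms_noL20`) with the EXOTIC
  piece quantified ONLY over those rows.

Census reading (EVIDENCE; kit j135556 / j135897 / j137075; `HOME/b2b-bsdres-n1011-p02/f4g6/`): of
the 749 `m = 3` census cells (`v₃(j − 1728) = 3`, surj(3)), 626 lie in a Hauptmodul class (tower
PROVED at class level), 123 are of SIG type; of these 103 carry a per-curve kernel tower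
(n1011-p10, rows T-b11-TINST / T-b11-F4-H) and the 20 Elkies curves are tower-less modulo the cited
moduli sentence (T-b11-ELK).  Nothing booked; X4 CONSTRUCTION-SHAPED; no label change.

References: [SerreAbelianLadic1968] IV §3.4 Lemma 3; [Maier2006] Table 4 (N = 3, 9), §5;
[Wuthrich2014] Lemma 20 (p. 399); [Elkies2006] §1, §4; [Kato2004Asterisque] Thm. 14.5 (3).
-/

noncomputable section

open scoped Classical

open WeierstrassCurve Literature.NumberTheory.EllipticCurves
  Literature.NumberTheory.EllipticCurves.ModularForms
  Literature.NumberTheory.EllipticCurves.Rank1Residual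
  Literature.NumberTheory.EllipticCurves.Rank1Residual.Typed
  Summit.BirchSwinnertonDyer.Rank1Residual.GaloisImage

namespace Summit.BirchSwinnertonDyer.Rank1Residual.Additive

section Signature

variable {W : WeierstrassCurve ℚ} [W.IsElliptic] [W.IsGloballyMinimal]

/-- **THE EXOTIC SIGNATURE OF X4 AT `3` AFTER THE HAUPTMODUL ROUTE.**  An X4 pair at `3` with
`ρ̄_{E,3}` onto whose `3`-adic tower fails is in the wild cell (w), has `v₃(j − 1728) ∈ {3, 0}`, has
`9 ∣ ord_q j` at every prime `q ≠ 3` with `ord_q j < 0` (T-b10 ARMS A/B), and — T-b11-F4-END — either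
`v₃(j − 1728) = 0` or `v₃(j) = V`, `j/3^V ≡ c (mod 9)` with `(V, c mod 9)` of SIGNATURE type.
[cite: SerreAbelianLadic1968, Ch. IV §3.4, Lemma 3 (IV-23)] [cite: Maier2006, Table 4 (N = 3, 9) and §5]
[cite: Wuthrich2014, Lemma 20 (p. 399)] [cite: Elkies2006, §1] -/
theorem ClassX4.exotic_hauptmodul_signature_of_not_towerSurj_three [Fact (Nat.Prime 3)]
    (hX : ClassX4 W 3) (hsurj : Surj W 3) (hnot : ¬ ∀ n : ℕ, W.HasSurjectiveModNGaloisRep (3 ^ n : ℕ)) :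
    SubW W 3 ∧ (padicValRat 3 (W.j - 1728) = 3 ∨ padicValRat 3 (W.j - 1728) = 0) ∧
    (padicValRat 3 (W.j - 1728) = 0 ∨
      ∃ (V : ℕ) (c : ℤ), padicValRat 3 W.j = V ∧ (9 : ℤ) ∣ (W.j / 3 ^ V - c).num ∧
        ((V = 3 ∧ c % 9 = 8) ∨
         (6 ≤ V ∧ V % 3 = 0 ∧ (c % 9 = 1 ∨ c % 9 = 8)) ∨
         (V = 7 ∧ (c % 9 = 2 ∨ c % 9 = 4)) ∨
         (8 ≤ V ∧ V % 3 ≠ 0 ∧ (c % 9 = 1 ∨ c % 9 = 8)))) ∧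
    ∀ q : ℕ, q.Prime → q ≠ 3 → padicValRat q W.j < 0 → (9 : ℤ) ∣ padicValRat q W.j := by
  obtain ⟨hS, harm, h9⟩ := ClassX4.exotic_arms_of_not_towerSurj_three hX hsurj hnot
  refine ⟨hS, harm, ?_, h9⟩
  rcases Summit.BirchSwinnertonDyer.Rank1Residual.GaloisImage.exotic_hauptmodul_signature_of_not_towerSurj_three
      W hsurj hnot with hle | hsig
  · exact Or.inl (le_antisymm hle (padicValRat_j_sub_1728_nonneg_of_subW hS))
  · exact Or.inr hsig

end Signature

/-! ### The X4 end-state with the EXOTIC piece on the Hauptmodul-signature rows only -/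

/-- **The EXOTIC hypothesis RESTRICTED to the Hauptmodul signature.**  p251574's EXOTIC piece
(`p = 3`, `r_an = 0`, X4, surj(3), `ord₃ j ≥ 0`, `¬ TypeG W 3`, tower fails ⟹ upper) is EQUIVALENT
to the same statement on the rows with `SubW W 3`, `v₃(j − 1728) ∈ {3, 0}`,
[`v₃(j − 1728) = 0` ∨ `(v₃(j), j/3^{v₃(j)} mod 9)` of SIGNATURE type], and `9 ∣ ord_q j` at every
prime `q ≠ 3` with `ord_q j < 0`. [cite: Wuthrich2014, Lemma 20 (p. 399)]
[cite: SerreAbelianLadic1968, Ch. IV §3.4, Lemma 3 (IV-23)] [cite: Maier2006, Table 4 (N = 3, 9) and §5]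
[cite: Elkies2006, §1] -/
theorem exotic_arms_iff_exotic_of_hauptmodul_signature :
    (∀ (W : WeierstrassCurve ℚ) [W.IsElliptic] [W.IsGloballyMinimal],
        W.analyticRank = 0 → ClassX4 W 3 → Surj W 3 → SubW W 3 →
        (padicValRat 3 (W.j - 1728) = 3 ∨ padicValRat 3 (W.j - 1728) = 0) →
        (∀ q : ℕ, q.Prime → q ≠ 3 → padicValRat q W.j < 0 → (9 : ℤ) ∣ padicValRat q W.j) →
        ¬ (∀ n : ℕ, W.HasSurjectiveModNGaloisRep (3 ^ n : ℕ)) → MissingUpperBoundAt W 3) ↔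
    (∀ (W : WeierstrassCurve ℚ) [W.IsElliptic] [W.IsGloballyMinimal],
        W.analyticRank = 0 → ClassX4 W 3 → Surj W 3 → SubW W 3 →
        (padicValRat 3 (W.j - 1728) = 3 ∨ padicValRat 3 (W.j - 1728) = 0) →
        (padicValRat 3 (W.j - 1728) = 0 ∨
          ∃ (V : ℕ) (c : ℤ), padicValRat 3 W.j = V ∧ (9 : ℤ) ∣ (W.j / 3 ^ V - c).num ∧
            ((V = 3 ∧ c % 9 = 8) ∨
             (6 ≤ V ∧ V % 3 = 0 ∧ (c % 9 = 1 ∨ c % 9 = 8)) ∨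
             (V = 7 ∧ (c % 9 = 2 ∨ c % 9 = 4)) ∨
             (8 ≤ V ∧ V % 3 ≠ 0 ∧ (c % 9 = 1 ∨ c % 9 = 8)))) →
        (∀ q : ℕ, q.Prime → q ≠ 3 → padicValRat q W.j < 0 → (9 : ℤ) ∣ padicValRat q W.j) →
        ¬ (∀ n : ℕ, W.HasSurjectiveModNGaloisRep (3 ^ n : ℕ)) → MissingUpperBoundAt W 3) := by
  haveI : Fact (Nat.Prime 3) := ⟨Nat.prime_three⟩
  constructor
  · intro h V _ _ hr hX hs hS harm _ h9 hnot
    exact h V hr hX hs hS harm h9 hnot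
  · intro h V _ _ hr hX hs hS harm h9 hnot
    exact h V hr hX hs hS harm (ClassX4.exotic_hauptmodul_signature_of_not_towerSurj_three hX hs hnot).2.2.1
      h9 hnot

/-- The same equivalence starting from p251574's UNRESTRICTED EXOTIC piece (`ord₃ j ≥ 0`, `¬ TypeG`,
tower fails ⟹ upper): `exotic_iff_exotic_of_arms` followed by
`exotic_arms_iff_exotic_of_hauptmodul_signature`. [cite: Wuthrich2014, Lemma 20 (p. 399)]
[cite: Maier2006, Table 4 (N = 3, 9) and §5] -/
theorem exotic_iff_exotic_of_hauptmodul_signature :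
    (∀ (W : WeierstrassCurve ℚ) [W.IsElliptic] [W.IsGloballyMinimal],
        W.analyticRank = 0 → ClassX4 W 3 → Surj W 3 → 0 ≤ padicValRat 3 W.j → ¬ TypeG W 3 →
        ¬ (∀ n : ℕ, W.HasSurjectiveModNGaloisRep (3 ^ n : ℕ)) → MissingUpperBoundAt W 3) ↔
    (∀ (W : WeierstrassCurve ℚ) [W.IsElliptic] [W.IsGloballyMinimal],
        W.analyticRank = 0 → ClassX4 W 3 → Surj W 3 → SubW W 3 →
        (padicValRat 3 (W.j - 1728) = 3 ∨ padicValRat 3 (W.j - 1728) = 0) →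
        (padicValRat 3 (W.j - 1728) = 0 ∨
          ∃ (V : ℕ) (c : ℤ), padicValRat 3 W.j = V ∧ (9 : ℤ) ∣ (W.j / 3 ^ V - c).num ∧
            ((V = 3 ∧ c % 9 = 8) ∨
             (6 ≤ V ∧ V % 3 = 0 ∧ (c % 9 = 1 ∨ c % 9 = 8)) ∨
             (V = 7 ∧ (c % 9 = 2 ∨ c % 9 = 4)) ∨
             (8 ≤ V ∧ V % 3 ≠ 0 ∧ (c % 9 = 1 ∨ c % 9 = 8)))) →
        (∀ q : ℕ, q.Prime → q ≠ 3 → padicValRat q W.j < 0 → (9 : ℤ) ∣ padicValRat q W.j) →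
        ¬ (∀ n : ℕ, W.HasSurjectiveModNGaloisRep (3 ^ n : ℕ)) → MissingUpperBoundAt W 3) :=
  exotic_iff_exotic_of_arms.trans exotic_arms_iff_exotic_of_hauptmodul_signature

/-- **THE END-STATE OF CLASS X4 ON EIGHT NAMED FACTS with the EXOTIC piece on the HAUPTMODUL-SIGNATURE
rows only: X4♯(unit-free) ⟺ LOWER ∧ EXOTIC((w) ∧ `v₃(j−1728) ∈ {3, 0}` ∧ [`v₃(j−1728) = 0` ∨ SIG] ∧
no level-9 `j`-witness) ∧ TAM-DEFECT₂♭ ∧ ODD-SHA♭ ∧ MANIN♭** — n1011-p14's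
`x4SharpUnitFree_iff_lower_and_residues_sharp_exoticArms_noL20` rewritten along
`exotic_iff_exotic_of_hauptmodul_signature`.  No named fact beyond the eight; X4 stays
CONSTRUCTION-SHAPED; nothing booked. [cite: Kato2004Asterisque, Thm. 14.5 (3) (p. 236), Thm. 17.4 (3) (p. 273)]
[cite: Delbourgo1998, Prop. 4 (p. 144)] [cite: Wuthrich2014, Lemma 20 (p. 399)] [cite: SilvermanAEC2009, Thm. X.4.14]
[cite: Kim2022StructureSelmer, Conj. 1.10 (PDF p. 8)] [cite: Miller2011LMS, Def. 1.1] [cite: Elkies2006, §1]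
[cite: Maier2006, Table 4 (N = 3, 9) and §5] -/
theorem x4SharpUnitFree_iff_lower_and_residues_sharp_exoticHauptmodul_noL20
    (hCT : exists_casselsTate_pairing (K := ℚ))
    (hKatoS : Kato2004.rankZero_padicValNat_sha_le_sub_localTamagawa_of_additive_potGood_of_imageContainsSL2)
    (hDel : Delbourgo1998.prop4_rankZero_pow_dvd_constantCoeff)
    (hGZK : rank_eq_analyticRank_of_analyticRank_le_one) (hmod : hasEntireLFunction_rat)
    (hmodD : nonempty_modularParametrizationData)
    (hKatoχ : Wuthrich2014.kato_halfEigenCharIdeal_dvd_cyclotomicPrime_of_surjective)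
    (hK : Kato2004.charIdeal_dvd_padicLFunctionBranch_component_of_surjective) :
    X4SharpUnitFree ↔
      (∀ (W : WeierstrassCurve ℚ) [W.IsElliptic] [W.IsGloballyMinimal] (p : ℕ) [Fact p.Prime],
          W.analyticRank = 0 → ClassX4 W p → Surj W p → MissingLowerBoundAt W p) ∧
      (∀ (W : WeierstrassCurve ℚ) [W.IsElliptic] [W.IsGloballyMinimal],
          W.analyticRank = 0 → ClassX4 W 3 → Surj W 3 → SubW W 3 →
          (padicValRat 3 (W.j - 1728) = 3 ∨ padicValRat 3 (W.j - 1728) = 0) →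
          (padicValRat 3 (W.j - 1728) = 0 ∨
            ∃ (V : ℕ) (c : ℤ), padicValRat 3 W.j = V ∧ (9 : ℤ) ∣ (W.j / 3 ^ V - c).num ∧
              ((V = 3 ∧ c % 9 = 8) ∨
               (6 ≤ V ∧ V % 3 = 0 ∧ (c % 9 = 1 ∨ c % 9 = 8)) ∨
               (V = 7 ∧ (c % 9 = 2 ∨ c % 9 = 4)) ∨
               (8 ≤ V ∧ V % 3 ≠ 0 ∧ (c % 9 = 1 ∨ c % 9 = 8)))) →
          (∀ q : ℕ, q.Prime → q ≠ 3 → padicValRat q W.j < 0 → (9 : ℤ) ∣ padicValRat q W.j) →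
          ¬ (∀ n : ℕ, W.HasSurjectiveModNGaloisRep (3 ^ n : ℕ)) → MissingUpperBoundAt W 3) ∧
      (∀ (W : WeierstrassCurve ℚ) [W.IsElliptic] [W.IsGloballyMinimal] (p : ℕ) [Fact p.Prime],
          W.analyticRank = 0 → ClassX4 W p → Surj W p → 0 ≤ padicValRat p W.j →
          ¬ (TypeGOrd W p ∧ semistabilityIndex W p = 2) →
          padicValNat p ((W.baseChange ℚ_[p]).localTamagawaNumber ℤ_[p]) + 2 ≤
            padicValNat p W.tamagawaProduct →
          MissingUpperBoundAt W p) ∧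
      (∀ (W : WeierstrassCurve ℚ) [W.IsElliptic] [W.IsGloballyMinimal] (p : ℕ) [Fact p.Prime],
          W.analyticRank = 0 → ClassX4 W p → Surj W p → 0 ≤ padicValRat p W.j →
          ¬ (TypeGOrd W p ∧ semistabilityIndex W p = 2) →
          (∃ q : ℚ, shaAn W = (q : ℂ) ∧ Odd (padicValRat p q)) → MissingUpperBoundAt W p) ∧
      (∀ (W : WeierstrassCurve ℚ) [W.IsElliptic] [W.IsGloballyMinimal] (p : ℕ) [Fact p.Prime],
          W.analyticRank = 0 → ClassX4 W p → Surj W p → 0 ≤ padicValRat p W.j →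
          ¬ (TypeGOrd W p ∧ semistabilityIndex W p = 2) →
          (∀ (N : ℕ) [NeZero N] (D : ModularParametrizationData W N), (p : ℤ) ∣ D.maninConstant) →
          MissingUpperBoundAt W p) := by
  rw [x4SharpUnitFree_iff_lower_and_residues_sharp_exoticArms_noL20 hCT hKatoS hDel hGZK hmod hmodD
    hKatoχ hK, exotic_arms_iff_exotic_of_hauptmodul_signature]

end Summit.BirchSwinnertonDyer.Rank1Residual.Additive
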